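import Mathlib.MeasureTheory.Integral.Bochner.ContinuousLinearMap
import Literature.NumberTheory.Automorphic.SmoothIndOpenCellLineCharacter      -- ★ T3a §1 («`Λ` descends»), ⇒ ★ T1 `SmoothIndCellFunTorusTransport`, ★ `SmoothIndOpenCellHaarFunctional`
import Literature.NumberTheory.Automorphic.SmoothInductionExactProofs          -- ★ `Representation.smoothIndMap` (functoriality of `Ind`)
import HarnessLib

/-!
# The open-cell Haar functional as an intertwiner `ℓ → W`: the `W`-valued geometric lemma for a two-cell parabolic triple

Topic `NumberTheory/Automorphic`; namespace `Literature.NumberTheory.Automorphic`.  THEOREMS ONLY (hypothesis style: every property is stated for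
ANY linear `Λ : ℓ → W` with the Haar formula, whose existence is `ParabolicTriple.exists_openCellFunctional`); no definition, no named fact, no `sorry`,
no instance, no notation.  Sequel of ★ `SmoothIndOpenCellLineCharacter` (T3a: the LINE case, scalar
action) — this file is its `W`-VALUED twin, the «(GL-jet) PORT» of the ★ N1 engine (cell `hodgecm-mathlib`, F0∕P3, CENSUS-R67 §3 (G1)∕§8 (O2);
★ N1 `U3PrincipalSeriesJacquetFiltration` carries `-- TODO(general form)`: the printed geometric lemma is for arbitrary smooth `σ`, not characters).

## The mathematics ([BernsteinZelevinsky1977, Geometrical Lemma 2.12, §5 (5.2), Prop. 1.9 (a)]; [Casselman1995, §6.3 Thm. 6.3.5, Lemma 7.1.1 (a)];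
## [BernsteinZelevinsky1976, §1.18–§1.19])

Frame of ★ `SmoothIndOpenCellHaarFunctional` ∕ ★ T1 ∕ ★ T3a: `t = (P, M, N)` a parabolic triple of a topological group `G`, `τ` a representation of `P`
on a finite-dimensional normed space `W`, `I = Ind_P^G τ` (★ `Representation.SmoothInd`), `r(I)` its normalised Jacquet module on the carrier
`(t.restrict I).Coinvariants` (★ `Representation.normalizedJacquet`), `w₀ ∈ G`, `μ` a right-invariant measure on `N` finite on compacts, and
`ℓ ≤ r(I)` the subspace of the classes of the sections vanishing at `1` («the open-cell part»; hypothesis `hℓ`, the shape exported by the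
closed-cell files), every such section having compactly supported cell function `n ↦ f(w₀ n)` (`hcs`).
* §1 **`W`-valued transport** (T1 §2 without the scalar hypothesis): for `m` with `w₀ m w₀⁻¹ ∈ P`, `n m = m c(n)`, `μ.map c = κ • μ`:
  `∫ (m·f)(w₀ n) dμ = κ • τ(w₀ m w₀⁻¹) (∫ f(w₀ n) dμ)` (a continuous linear map commutes with the Bochner integral).
* §2 **THE HAAR FUNCTIONAL ON `ℓ` EXISTS**: a linear `Λ : ℓ →ₗ[ℂ] W` with `Λ [f] = ∫_N f(w₀ n) dμ(n)` for every section `f` vanishing at `1` — well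
  defined because the integral DESCENDS to Jacquet-module classes (★ T3a §1 `ParabolicTriple.integral_cellFun_eq_of_mk_restrict_eq`, left exactness).
* §3 **`Λ` IS SURJECTIVE** as soon as every `w ∈ W` is the value of an indicator cell function `1_K · w` of a section vanishing at `1` (★
  `CMPrincipalSeriesOpenCellSection.exists_openCellSection` supplies these); hence `finrank W ≤ finrank ℓ`, and with the UPPER bound `finrank ℓ ≤ finrank W`
  of ★ `SmoothIndOpenCellCoinvariants` (taken as a hypothesis here) **`finrank ℓ = finrank W` and `Λ` is a linear isomorphism `ℓ ≃ W`**
  («the coinvariants of `C_c^∞(N, W)` are `W`, via the Haar integral» — the equality ★ `CompactlySupportedCoinvariants` deliberately left out).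
* §4 **`Λ` INTERTWINES**: `ℓ` is `r(M)`-stable and `Λ (r(m) x) = (δ_P^{-1∕2}(m) · κ_m) • τ(w₀ m w₀⁻¹) (Λ x)` — the normalised Jacquet action on the
  open-cell part is `τ^{w₀} ⊗ δ_P^{-1∕2} κ` («`(w⁻¹σ) δ^{1∕2}`» of [Casselman1995, L. 7.1.1 (a)], `W`-valued).
* §5 **NATURALITY in `τ`**: for a `P`-map `u : τ → τ′`, `Λ′ [Ind(u) f] = u (Λ [f])` (★ `Representation.smoothIndMap`, `(Ind(u) f)(x) = u (f x)`); in
  the jet application (G1) this is the `ℂ[ε]`-linearity (`ε = Ind(E)`, `E ∈ End_M(N₀)`).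
HC_CM is proved only modulo the printed citations until rung 0 closes; this file is generic representation theory and discharges no named fact.

## References
* [BernsteinZelevinsky1977] I. N. Bernstein, A. V. Zelevinsky, *Induced representations of reductive `p`-adic groups. I*, Ann. Sci. ÉNS (4) 10
  (1977), Prop. 1.9 (a), §2.3, Geometrical Lemma 2.12, §5 (Thm. 5.2).
* [BernsteinZelevinsky1976] I. N. Bernstein, A. V. Zelevinsky, Russian Math. Surveys 31:3 (1976), §1.18–§1.19, §2.22–§2.35.
* [Casselman1995] W. Casselman, *Introduction to the theory of admissible representations of `p`-adic reductive groups* (1995), §3.2, §6.3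
  (Thm. 6.3.5), Lemma 7.1.1 (a).
-/

set_option autoImplicit false

noncomputable section

open MeasureTheory
open scoped NNReal ENNReal

namespace Literature.NumberTheory.Automorphic

/-! ## §1 `W`-valued transport of the Haar functional under an element normalising the cell -/

section Transport

variable {G : Type*} [Group G] [TopologicalSpace G] [IsTopologicalGroup G] (H : Subgroup G)
  {W : Type*} [NormedAddCommGroup W] [NormedSpace ℂ W] [CompleteSpace W] (σ : Representation ℂ H W)
  {Γ : Type*} [Group Γ] [TopologicalSpace Γ] [IsTopologicalGroup Γ] [MeasurableSpace Γ] [BorelSpace Γ] [SecondCountableTopologyEither Γ W]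
  (ι : Γ →* G) (w₀ : G) (μ : Measure Γ) [IsFiniteMeasureOnCompacts μ]

/-- **THE `W`-VALUED TRANSPORT FORMULA `λ(m · f) = κ • σ(w₀ m w₀⁻¹) λ(f)`** (★ T1 `SmoothInd.integral_cellFun_smoothIndRep_of_conj` without the
scalar hypothesis): for `m` with `w₀ m w₀⁻¹ ∈ H`, `ι(γ) m = m ι(c γ)` (`c` measurable, `μ.map c = κ • μ`), `A` a continuous linear map agreeing with
`σ(w₀ m w₀⁻¹)` on `W`, and `f` with compactly supported cell function: `∫ (m·f)(w₀ ι γ) dμ = κ • A (∫ f(w₀ ι γ) dμ)` (the cell function of `m · f` is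
`A ∘ (cell function of f) ∘ c`, ★ `SmoothInd.cellFun_smoothIndRep_of_conj'`; change of variables; `A` commutes with the Bochner integral).
[cite: BernsteinZelevinsky1977, §5 (5.2) and Geometrical Lemma 2.12] [cite: Casselman1995, §6.3 (proof of Thm. 6.3.5)] -/
theorem SmoothInd.integral_cellFun_smoothIndRep_of_conj_clm (hι : Continuous ι) (m : G) (hm : w₀ * m * w₀⁻¹ ∈ H) (c : Γ → Γ)
    (hcm : Measurable c) (hc : ∀ γ, ι γ * m = m * ι (c γ)) {κ : ℝ≥0} (hμ : μ.map c = κ • μ) (A : W →L[ℂ] W)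
    (hA : ∀ w, σ ⟨w₀ * m * w₀⁻¹, hm⟩ w = A w) {f : Representation.SmoothInd H σ}
    (hf : HasCompactSupport fun γ => f.toFun (w₀ * ι γ)) :
    ∫ γ, (Representation.smoothIndRep H σ m f).toFun (w₀ * ι γ) ∂μ = (κ : ℂ) • A (∫ γ, f.toFun (w₀ * ι γ) ∂μ) := by
  rw [SmoothInd.cellFun_smoothIndRep_of_conj' ι w₀ m hm c hc f]
  simp_rw [hA]
  -- change of variables `γ ↦ c γ`
  have hcont : Continuous fun γ => A (f.toFun (w₀ * ι γ)) := A.continuous.comp (SmoothInd.continuous_cellFun H σ ι w₀ hι f)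
  have h := integral_map (μ := μ) hcm.aemeasurable (f := fun γ => A (f.toFun (w₀ * ι γ))) hcont.aestronglyMeasurable
  rw [hμ, integral_smul_nnreal_measure] at h
  change ∫ γ, A (f.toFun (w₀ * ι (c γ))) ∂μ = _
  rw [← h, A.integral_comp_comm (SmoothInd.integrable_cellFun H σ ι w₀ μ hι hf), NNReal.smul_def, Complex.coe_smul]

end Transport

/-! ## §2 The Haar functional `Λ : ℓ → W` on the open-cell part of the Jacquet module (existence; hypothesis style) -/

section Parabolic

variable {G : Type*} [Group G] [TopologicalSpace G] [IsTopologicalGroup G] (t : ParabolicTriple G)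
  {W : Type*} [NormedAddCommGroup W] [NormedSpace ℂ W] (τ : Representation ℂ ↥t.P W)
  [MeasurableSpace ↥t.N] [BorelSpace ↥t.N]
  (μ : Measure ↥t.N) [IsFiniteMeasureOnCompacts μ] (w₀ : G)
  (ℓ : Submodule ℂ (t.restrict (Representation.smoothIndRep t.P τ)).Coinvariants)
  (hℓ : ∀ x, x ∈ ℓ ↔ ∃ f : Representation.SmoothInd t.P τ,
    f.toFun 1 = 0 ∧ Representation.Coinvariants.mk (t.restrict (Representation.smoothIndRep t.P τ)) f = x)

include hℓ

omit [MeasurableSpace ↥t.N] [BorelSpace ↥t.N] in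
/-- the class of a section vanishing at `1` lies in `ℓ` (one direction of `hℓ`, named for the subtype binders below; the functions vanishing on the
closed cell `P` are the first step of the Bruhat filtration of `Ind|_P`). [cite: Casselman1995, §6.3] [cite: BernsteinZelevinsky1977, §5 (5.2)] -/
theorem ParabolicTriple.mk_mem_openCell {f : Representation.SmoothInd t.P τ} (hf : f.toFun 1 = 0) :
    Representation.Coinvariants.mk (t.restrict (Representation.smoothIndRep t.P τ)) f ∈ ℓ :=
  (hℓ _).2 ⟨f, hf, rfl⟩

omit [MeasurableSpace ↥t.N] [BorelSpace ↥t.N] in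
/-- **`ℓ` is stable under the (normalised) Jacquet action of `M`**: `r(m)[f] = δ_P^{-1∕2}(m) [m · f]` and `(m · f)(1) = τ(m) f(1) = 0`.
[cite: BernsteinZelevinsky1977, §2.3] [cite: Casselman1995, §6.3] -/
theorem ParabolicTriple.normalizedJacquet_mem_openCell [LocallyCompactSpace ↥t.P] (m : ↥t.M)
    {x : (t.restrict (Representation.smoothIndRep t.P τ)).Coinvariants} (hx : x ∈ ℓ) :
    (Representation.smoothIndRep t.P τ).normalizedJacquet t m x ∈ ℓ := by
  obtain ⟨f, hf, rfl⟩ := (hℓ x).1 hx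
  rw [Representation.normalizedJacquet_mk]
  exact ℓ.smul_mem _ ((hℓ _).2 ⟨_, SmoothInd.toFun_one_smoothIndRep_eq_zero t τ (t.M_le m.2) f hf, rfl⟩)

/-- **EXISTENCE OF THE OPEN-CELL HAAR FUNCTIONAL `Λ : ℓ →ₗ[ℂ] W` WITH `Λ [f] = ∫_N f(w₀ n) dμ(n)`** for EVERY section `f` vanishing at `1`
(`N` the union of its compact open subgroups, every such section with compactly supported cell function).  Construction: the integral of the
cell function of any representative vanishing at `1`; well defined and linear because the integral DESCENDS to Jacquet-module classes
(★ `ParabolicTriple.integral_cellFun_eq_of_mk_restrict_eq`, left exactness of coinvariants [BernsteinZelevinsky1977, Prop. 1.9 (a)]).  All further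
properties (§3–§5) are stated for ANY linear `Λ` with this formula (hypothesis `hΛ`).
[cite: BernsteinZelevinsky1977, Prop. 1.9 (a), §5 (5.2)] [cite: Casselman1995, §6.3 (proof of Thm. 6.3.5)] [cite: BernsteinZelevinsky1976, §1.18–§1.19] -/
theorem ParabolicTriple.exists_openCellFunctional [μ.IsMulRightInvariant] (hN : IsLimitOfCompactOpen ↥t.N)
    (hcs : ∀ f : Representation.SmoothInd t.P τ, f.toFun 1 = 0 → HasCompactSupport fun n : ↥t.N => f.toFun (w₀ * n)) :
    ∃ Λ : ↥ℓ →ₗ[ℂ] W, ∀ (f : Representation.SmoothInd t.P τ) (hf : f.toFun 1 = 0),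
      Λ ⟨_, t.mk_mem_openCell τ ℓ hℓ hf⟩ = ∫ n, f.toFun (w₀ * n) ∂μ := by
  -- the value on a class: the integral of the cell function of a chosen representative vanishing at `1`
  have key : ∀ (x : ↥ℓ) (f : Representation.SmoothInd t.P τ), f.toFun 1 = 0 →
      Representation.Coinvariants.mk (t.restrict (Representation.smoothIndRep t.P τ)) f = x →
      ∫ n, (Classical.choose ((hℓ x.1).1 x.2)).toFun (w₀ * n) ∂μ = ∫ n, f.toFun (w₀ * n) ∂μ := fun x f hf hfx => by
    have hx := Classical.choose_spec ((hℓ x.1).1 x.2)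
    exact ParabolicTriple.integral_cellFun_eq_of_mk_restrict_eq t τ μ w₀ hN _ f (hcs _ hx.1) (hcs _ hf) (hx.2.trans hfx.symm)
  refine ⟨{ toFun := fun x => ∫ n, (Classical.choose ((hℓ x.1).1 x.2)).toFun (w₀ * n) ∂μ
            map_add' := fun x y => ?_
            map_smul' := fun a x => ?_ }, fun f hf => key _ f hf rfl⟩
  · obtain ⟨fx, hx, hfx⟩ := (hℓ x.1).1 x.2
    obtain ⟨fy, hy, hfy⟩ := (hℓ y.1).1 y.2
    have h1 : (fx + fy).toFun 1 = 0 := by rw [Representation.SmoothInd.toFun_add, Pi.add_apply, hx, hy, add_zero]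
    rw [key x fx hx hfx, key y fy hy hfy, key (x + y) (fx + fy) h1 (by rw [map_add, hfx, hfy, Submodule.coe_add])]
    simp only [Representation.SmoothInd.toFun_add, Pi.add_apply]
    exact integral_add (SmoothInd.integrable_cellFun t.P τ t.N.subtype w₀ μ continuous_subtype_val (hcs _ hx))
      (SmoothInd.integrable_cellFun t.P τ t.N.subtype w₀ μ continuous_subtype_val (hcs _ hy))
  · obtain ⟨fx, hx, hfx⟩ := (hℓ x.1).1 x.2
    have h1 : (a • fx).toFun 1 = 0 := by rw [Representation.SmoothInd.toFun_smul, Pi.smul_apply, hx, smul_zero]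
    rw [key x fx hx hfx, key (a • x) (a • fx) h1 (by rw [map_smul, hfx, Submodule.coe_smul])]
    simp only [Representation.SmoothInd.toFun_smul, Pi.smul_apply, integral_smul, RingHom.id_apply]

/-! ## §3 Surjectivity, `finrank ℓ = finrank W`, bijectivity — for any `Λ` with the Haar formula -/

variable (Λ : ↥ℓ →ₗ[ℂ] W)
  (hΛ : ∀ (f : Representation.SmoothInd t.P τ) (hf : f.toFun 1 = 0), Λ ⟨_, t.mk_mem_openCell τ ℓ hℓ hf⟩ = ∫ n, f.toFun (w₀ * n) ∂μ)

include hΛ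

omit [IsFiniteMeasureOnCompacts μ] in
/-- **`Λ [Φ] = μ(K) • w` for a section with indicator cell function `1_K · w`.** [cite: BernsteinZelevinsky1976, §1.18–§1.19]
[cite: Casselman1995, §6.3] -/
theorem ParabolicTriple.openCellFunctional_mk_of_indicator [CompleteSpace W] (Φ : Representation.SmoothInd t.P τ) (hΦ1 : Φ.toFun 1 = 0)
    {K : Set ↥t.N} (hKo : IsOpen K) {w : W} (hΦK : ∀ n : ↥t.N, Φ.toFun (w₀ * n) = K.indicator (fun _ => w) n) :
    Λ ⟨_, t.mk_mem_openCell τ ℓ hℓ hΦ1⟩ = ((μ.real K : ℝ) : ℂ) • w := by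
  rw [hΛ Φ hΦ1, show (fun n : ↥t.N => Φ.toFun (w₀ * n)) = K.indicator (fun _ => w) from funext hΦK,
    integral_indicator_const w hKo.measurableSet, Complex.coe_smul]

/-- **`Λ` IS SURJECTIVE** when every `w ∈ W` is carried by a section vanishing at `1` with indicator cell function `1_K · w`, `K` non-empty compact
open (★ `CMPrincipalSeriesOpenCellSection.exists_openCellSection`), and `μ` charges open sets: `Λ [Φ_{K,w}] = μ(K) • w` with `0 < μ(K) < ∞`.
[cite: BernsteinZelevinsky1976, §1.18–§1.19] [cite: BernsteinZelevinsky1977, §5 (5.2)] -/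
theorem ParabolicTriple.openCellFunctional_surjective [CompleteSpace W] [μ.IsOpenPosMeasure]
    (hsec : ∀ w : W, ∃ Φ : Representation.SmoothInd t.P τ, Φ.toFun 1 = 0 ∧ ∃ K : Set ↥t.N, IsOpen K ∧ IsCompact K ∧ K.Nonempty ∧
      ∀ n : ↥t.N, Φ.toFun (w₀ * n) = K.indicator (fun _ => w) n) :
    Function.Surjective Λ := by
  intro w
  obtain ⟨Φ, hΦ1, K, hKo, hKc, hKn, hΦK⟩ := hsec w
  have hK : ((μ.real K : ℝ) : ℂ) ≠ 0 := by
    rw [Complex.ofReal_ne_zero, Measure.real, ENNReal.toReal_ne_zero]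
    exact ⟨(hKo.measure_pos μ hKn).ne', (hKc.measure_lt_top (μ := μ)).ne⟩
  refine ⟨((μ.real K : ℝ) : ℂ)⁻¹ • ⟨_, t.mk_mem_openCell τ ℓ hℓ hΦ1⟩, ?_⟩
  rw [map_smul, t.openCellFunctional_mk_of_indicator τ μ w₀ ℓ hℓ Λ hΛ Φ hΦ1 hKo hΦK, smul_smul, inv_mul_cancel₀ hK, one_smul]

/-- **`finrank ℓ = finrank W`**: `Λ` surjective gives `finrank W ≤ finrank ℓ`; the reverse inequality is the open-cell UPPER bound of the
geometric lemma (★ `SmoothIndOpenCellCoinvariants.finrank_le_of_forall_mem_iff_exists_toFun_one_eq_zero`), taken as the hypotheses `hfin`, `hle`.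
[cite: BernsteinZelevinsky1977, Geometrical Lemma 2.12 and Thm. 5.2] [cite: Casselman1995, Lemma 7.1.1 (a)] -/
theorem ParabolicTriple.finrank_openCell_eq [CompleteSpace W] [μ.IsOpenPosMeasure] (hfin : FiniteDimensional ℂ ↥ℓ)
    (hle : Module.finrank ℂ ↥ℓ ≤ Module.finrank ℂ W)
    (hsec : ∀ w : W, ∃ Φ : Representation.SmoothInd t.P τ, Φ.toFun 1 = 0 ∧ ∃ K : Set ↥t.N, IsOpen K ∧ IsCompact K ∧ K.Nonempty ∧
      ∀ n : ↥t.N, Φ.toFun (w₀ * n) = K.indicator (fun _ => w) n) :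
    Module.finrank ℂ ↥ℓ = Module.finrank ℂ W := by
  haveI := hfin
  refine le_antisymm hle ?_
  have htop : LinearMap.range Λ = ⊤ := LinearMap.range_eq_top.2 (t.openCellFunctional_surjective τ μ w₀ ℓ hℓ Λ hΛ hsec)
  calc Module.finrank ℂ W = Module.finrank ℂ ↥(LinearMap.range Λ) := ((LinearEquiv.ofTop _ htop).finrank_eq).symm
    _ ≤ Module.finrank ℂ ↥ℓ := LinearMap.finrank_range_le _

/-- **`Λ` IS BIJECTIVE** — «the open-cell part of the Jacquet module IS `W`, via the Haar integral» (surjective between spaces of the same finite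
dimension; `LinearEquiv.ofBijective Λ` is then an isomorphism `ℓ ≃ₗ[ℂ] W` intertwining `r(m)|_ℓ` with `δ_P^{-1∕2}(m) κ_m · τ(w₀ m w₀⁻¹)` by §4).
[cite: BernsteinZelevinsky1977, Geometrical Lemma 2.12 and Thm. 5.2] [cite: Casselman1995, Thm. 6.3.5, Lemma 7.1.1 (a)] [cite: BernsteinZelevinsky1976, §1.18–§1.19] -/
theorem ParabolicTriple.openCellFunctional_bijective [CompleteSpace W] [μ.IsOpenPosMeasure] [FiniteDimensional ℂ W] (hfin : FiniteDimensional ℂ ↥ℓ)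
    (hle : Module.finrank ℂ ↥ℓ ≤ Module.finrank ℂ W)
    (hsec : ∀ w : W, ∃ Φ : Representation.SmoothInd t.P τ, Φ.toFun 1 = 0 ∧ ∃ K : Set ↥t.N, IsOpen K ∧ IsCompact K ∧ K.Nonempty ∧
      ∀ n : ↥t.N, Φ.toFun (w₀ * n) = K.indicator (fun _ => w) n) :
    Function.Bijective Λ := by
  haveI := hfin
  have hsurj := t.openCellFunctional_surjective τ μ w₀ ℓ hℓ Λ hΛ hsec
  exact ⟨(LinearMap.injective_iff_surjective_of_finrank_eq_finrank
    (t.finrank_openCell_eq τ μ w₀ ℓ hℓ Λ hΛ hfin hle hsec)).2 hsurj, hsurj⟩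

/-! ## §4 `Λ` intertwines `r(m)|_ℓ` with `δ_P^{-1∕2}(m) κ_m · τ(w₀ m w₀⁻¹)` -/

/-- **`Λ` INTERTWINES THE JACQUET ACTION WITH `τ^{w₀} ⊗ δ_P^{-1∕2} κ`** ([Casselman1995, Lemma 7.1.1 (a)], `W`-valued; [BernsteinZelevinsky1977,
Geometrical Lemma 2.12]): for `m ∈ M` with `w₀ m w₀⁻¹ ∈ P`, `n m = m c(n)` on `N` (`c` measurable, `μ.map c = κ • μ`), `A` a continuous linear map
agreeing with `τ(w₀ m w₀⁻¹)`, every section vanishing at `1` having compactly supported cell function (`hcs`), and every `x ∈ ℓ`: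
**`Λ (r(m) x) = (δ_P^{-1∕2}(m) · κ) • A (Λ x)`**.  (The LINE case with `A = s` is ★ T3a `ParabolicTriple.normalizedJacquet_eq_smul_of_openCellLine`.)
[cite: Casselman1995, Lemma 7.1.1 (a) and §6.3] [cite: BernsteinZelevinsky1977, §5 (5.2) and Geometrical Lemma 2.12] -/
theorem ParabolicTriple.openCellFunctional_normalizedJacquet [LocallyCompactSpace ↥t.P] [CompleteSpace W] [SecondCountableTopologyEither ↥t.N W]
    (hcs : ∀ f : Representation.SmoothInd t.P τ, f.toFun 1 = 0 → HasCompactSupport fun n : ↥t.N => f.toFun (w₀ * n))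
    (m : ↥t.M) (hm : w₀ * (m : G) * w₀⁻¹ ∈ t.P) (c : ↥t.N → ↥t.N)
    (hcm : Measurable c) (hc : ∀ n : ↥t.N, (n : G) * (m : G) = (m : G) * (c n : G)) {κ : ℝ≥0} (hμ : μ.map c = κ • μ)
    (A : W →L[ℂ] W) (hA : ∀ w : W, τ ⟨w₀ * (m : G) * w₀⁻¹, hm⟩ w = A w)
    {x : (t.restrict (Representation.smoothIndRep t.P τ)).Coinvariants} (hx : x ∈ ℓ) :
    Λ ⟨_, t.normalizedJacquet_mem_openCell τ ℓ hℓ m hx⟩ =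
      ((((rootDeltaChar t.P (Subgroup.inclusion t.M_le m))⁻¹ : ℂˣ) : ℂ) * (κ : ℂ)) • A (Λ ⟨x, hx⟩) := by
  obtain ⟨f, hf, rfl⟩ := (hℓ x).1 hx
  set δ : ℂ := (((rootDeltaChar t.P (Subgroup.inclusion t.M_le m))⁻¹ : ℂˣ) : ℂ) with hδ
  have hmf1 : (Representation.smoothIndRep t.P τ (m : G) f).toFun 1 = 0 := SmoothInd.toFun_one_smoothIndRep_eq_zero t τ (t.M_le m.2) f hf
  have h1 : (δ • Representation.smoothIndRep t.P τ (m : G) f).toFun 1 = 0 := by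
    rw [Representation.SmoothInd.toFun_smul, Pi.smul_apply, hmf1, smul_zero]
  -- `r(m)[f] = [δ • m·f]`, the class of a section vanishing at `1`
  have hcls : (Representation.smoothIndRep t.P τ).normalizedJacquet t m
      (Representation.Coinvariants.mk (t.restrict (Representation.smoothIndRep t.P τ)) f) =
      Representation.Coinvariants.mk (t.restrict (Representation.smoothIndRep t.P τ)) (δ • Representation.smoothIndRep t.P τ (m : G) f) := by
    rw [Representation.normalizedJacquet_mk, map_smul]
  have hval : Λ ⟨_, t.normalizedJacquet_mem_openCell τ ℓ hℓ m (t.mk_mem_openCell τ ℓ hℓ hf)⟩ =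
      ∫ n, (δ • Representation.smoothIndRep t.P τ (m : G) f).toFun (w₀ * n) ∂μ :=
    (congrArg Λ (Subtype.ext hcls)).trans (hΛ _ h1)
  have hT : ∫ n : ↥t.N, (Representation.smoothIndRep t.P τ (m : G) f).toFun (w₀ * n) ∂μ =
      (κ : ℂ) • A (∫ n : ↥t.N, f.toFun (w₀ * n) ∂μ) :=
    SmoothInd.integral_cellFun_smoothIndRep_of_conj_clm t.P τ t.N.subtype w₀ μ continuous_subtype_val (m : G) hm c hcm hc hμ A hA (hcs f hf)
  rw [hval, hΛ f hf]
  simp only [Representation.SmoothInd.toFun_smul, Pi.smul_apply, integral_smul]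
  rw [hT, smul_smul]

end Parabolic

/-! ## §5 Naturality in `τ` -/

section Naturality

variable {G : Type*} [Group G] [TopologicalSpace G] [IsTopologicalGroup G] (t : ParabolicTriple G)
  {W : Type*} [NormedAddCommGroup W] [NormedSpace ℂ W] [CompleteSpace W] (τ : Representation ℂ ↥t.P W)
  {W' : Type*} [NormedAddCommGroup W'] [NormedSpace ℂ W'] [CompleteSpace W'] (τ' : Representation ℂ ↥t.P W')
  [MeasurableSpace ↥t.N] [BorelSpace ↥t.N]
  (μ : Measure ↥t.N) [IsFiniteMeasureOnCompacts μ] (w₀ : G)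
  (ℓ : Submodule ℂ (t.restrict (Representation.smoothIndRep t.P τ)).Coinvariants)
  (hℓ : ∀ x, x ∈ ℓ ↔ ∃ f : Representation.SmoothInd t.P τ,
    f.toFun 1 = 0 ∧ Representation.Coinvariants.mk (t.restrict (Representation.smoothIndRep t.P τ)) f = x)
  (ℓ' : Submodule ℂ (t.restrict (Representation.smoothIndRep t.P τ')).Coinvariants)
  (hℓ' : ∀ x, x ∈ ℓ' ↔ ∃ f : Representation.SmoothInd t.P τ',
    f.toFun 1 = 0 ∧ Representation.Coinvariants.mk (t.restrict (Representation.smoothIndRep t.P τ')) f = x)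

omit [CompleteSpace W] [MeasurableSpace ↥t.N] [BorelSpace ↥t.N] [CompleteSpace W'] in
/-- `Ind(u)` preserves vanishing at `1`: `(Ind(u) f)(1) = u (f 1)` (functoriality of `Ind`, `f ↦ u ∘ f`). [cite: BernsteinZelevinsky1977, §1.8] -/
theorem SmoothInd.toFun_one_smoothIndMap_eq_zero (u : τ.IntertwiningMap τ') {f : Representation.SmoothInd t.P τ} (hf : f.toFun 1 = 0) :
    (Representation.smoothIndMap t.P u f).toFun 1 = 0 := by
  rw [Representation.toFun_smoothIndMap, hf, map_zero]

include hℓ hℓ'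

omit [CompleteSpace W] [MeasurableSpace ↥t.N] [BorelSpace ↥t.N] [CompleteSpace W'] in
/-- **the Jacquet functor carries `ℓ` into `ℓ′`**: `r(Ind(u)) [f] = [Ind(u) f]` (★ `Representation.jacquetMap_mk`). [cite: BernsteinZelevinsky1977, §1.8] -/
theorem ParabolicTriple.jacquetMap_smoothIndMap_mem_openCell (u : τ.IntertwiningMap τ')
    {x : (t.restrict (Representation.smoothIndRep t.P τ)).Coinvariants} (hx : x ∈ ℓ) :
    Representation.jacquetMap t (Representation.smoothIndMap t.P u) x ∈ ℓ' := by
  obtain ⟨f, hf, rfl⟩ := (hℓ x).1 hx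
  rw [Representation.jacquetMap_mk]
  exact (hℓ' _).2 ⟨_, SmoothInd.toFun_one_smoothIndMap_eq_zero t τ τ' u hf, rfl⟩

/-- **NATURALITY OF `Λ` IN `τ`**: for `Λ`, `Λ′` with the Haar formula on `ℓ ≤ r(Ind τ)`, `ℓ′ ≤ r(Ind τ′)`, a `P`-intertwining map `u : τ → τ′`
agreeing with the continuous linear map `U`, and every `x ∈ ℓ`: `Λ′ (r(Ind(u)) x) = U (Λ x)` (the cell function of `Ind(u) f` is `u ∘` the cell
function of `f`, ★ `Representation.toFun_smoothIndMap`; `U` commutes with the Bochner integral).  In the jet application ((G1) of CENSUS-R67)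
`u = E ∈ End_M(N₀)` and this is the `ℂ[ε]`-linearity of the open-cell isomorphism. [cite: BernsteinZelevinsky1977, §1.8 and Geometrical Lemma 2.12]
[cite: Casselman1995, §6.3] -/
theorem ParabolicTriple.openCellFunctional_jacquetMap_smoothIndMap
    (hcs : ∀ f : Representation.SmoothInd t.P τ, f.toFun 1 = 0 → HasCompactSupport fun n : ↥t.N => f.toFun (w₀ * n))
    (Λ : ↥ℓ →ₗ[ℂ] W)
    (hΛ : ∀ (f : Representation.SmoothInd t.P τ) (hf : f.toFun 1 = 0), Λ ⟨_, t.mk_mem_openCell τ ℓ hℓ hf⟩ = ∫ n, f.toFun (w₀ * n) ∂μ)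
    (Λ' : ↥ℓ' →ₗ[ℂ] W')
    (hΛ' : ∀ (f : Representation.SmoothInd t.P τ') (hf : f.toFun 1 = 0), Λ' ⟨_, t.mk_mem_openCell τ' ℓ' hℓ' hf⟩ = ∫ n, f.toFun (w₀ * n) ∂μ)
    (u : τ.IntertwiningMap τ') (U : W →L[ℂ] W') (hU : ∀ w, u w = U w)
    {x : (t.restrict (Representation.smoothIndRep t.P τ)).Coinvariants} (hx : x ∈ ℓ) :
    Λ' ⟨_, t.jacquetMap_smoothIndMap_mem_openCell τ τ' ℓ hℓ ℓ' hℓ' u hx⟩ = U (Λ ⟨x, hx⟩) := by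
  obtain ⟨f, hf, rfl⟩ := (hℓ x).1 hx
  have h1 := SmoothInd.toFun_one_smoothIndMap_eq_zero t τ τ' u hf
  have hval : Λ' ⟨_, t.jacquetMap_smoothIndMap_mem_openCell τ τ' ℓ hℓ ℓ' hℓ' u (t.mk_mem_openCell τ ℓ hℓ hf)⟩ =
      ∫ n, (Representation.smoothIndMap t.P u f).toFun (w₀ * n) ∂μ :=
    (congrArg Λ' (Subtype.ext (Representation.jacquetMap_mk t (Representation.smoothIndMap t.P u) f))).trans (hΛ' _ h1)
  rw [hval, hΛ f hf]
  simp only [Representation.toFun_smoothIndMap, hU]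
  exact U.integral_comp_comm (SmoothInd.integrable_cellFun t.P τ t.N.subtype w₀ μ continuous_subtype_val (hcs f hf))

end Naturality

end Literature.NumberTheory.Automorphic

end
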